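import Summits.QuantumFields.BalabanUV.T4Continuum.Support.CompositeFibreRelabel
import Summits.QuantumFields.BalabanUV.T4Continuum.Support.CompositeTaxiFrameGap
import Summits.QuantumFields.BalabanUV.T4Continuum.Support.VariationalColourTaxiTowerProjG
import Summits.QuantumFields.BalabanUV.T4Continuum.Support.VariationalColourTaxiTowerEnd
import Summits.QuantumFields.BalabanUV.T4Continuum.Support.VariationalVectorTaxiOneStep

/-!
# T⁴ programme, spine node NE2 (U1a), lane P2 — THE THREE COMPARISON DATA OF THE (ONE-min) TRANSFER AT BAŁABAN's TAXI DATA: the kernel swap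
# (composite taxi frames → straight taxi of level k+1), the carrier defect (`frameT` → `lineT ∘ taxiTv` one-step carriers) and the fine V-UB leaf, all in the
# letters of the vector END of parts 6–8 (item «ONE-MIN AT TAXI DATA — THE COMPOSITE-FIBRE ↔ TAXI-FRAME BRIDGE», file 4a; model level; cell `pub-balaban`)

NE2 formalisation swarm `b2b-balaban-t4-ne2-formalise-*`, leaf prover 04 GEN 7 (`prover-b2b-balaban-t4-ne2-formalise-leaf-04-g7-0`); register row «P2-sup» of
`t4/formal/NE2/LEAVES.md`; journal CLAIMS.log INTENT 2026-08-20 l.21025, files 1–3 PROPOSED l.21609.  Compositions BY NAME of leaf-03-g7's relabelling file `CompositeFibreRelabel.projG_taxiTwoStep_eq`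
(p236855, STEP (i) of the bridge; this lineage's duplicate `ProjGRelabel` p237015 was WITHDRAWN after the dedup bounce), this lineage's file 2 of the item
(`CompositeTaxiFrameGap.{projG_taxi_le_comp, plaq_Rtrv_le}`, p237060), gen 4 ∕ 5 (`VariationalVectorTaxiOneStep.lineT_sub_frameT_taxi_le`,
`VariationalColourTaxiTower.{Rlev, nestLv, coarseTv_eq_Rlev, Rlev_mem_unitary, norm_nestLv_le_one}`, `VariationalColourTaxiTowerEnd.{exists_ubV_nestLv_SfV,
qVV_le_nestLv_of_garding}`, `VariationalColourTaxiTowerProjG.{hGF_projG_taxi, hGar_projG_nestLv}`), leaf-10-g3's `VariationalVectorTower.{SfV_eq_transport, QvL_comp',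
roughV_transport, Gtr_pullback}` ∕ `VariationalVectorWeitzenbock.divSq_le_mul_roughV`, the tree's `RegularGaugePerturbation.nsqV_QvL_le_of_norm_le` ∕
`VariationalVectorAverage.nsqV_QvL_le_qWV`.  Nothing defined.

THE LETTERS (level `k`, `n = L^k`; `R′ k` the one-step bonds, `Rlev k` the level bonds, coherent tower): coarse frames `T := taxiTv (L^k) M (Rlev k)`, one-step frames
`T′ := taxiTv L (fine (L^k) M) (R′ k)`; the END's one-step carriers `Q₂ := QvL L _ (lineT L _ T′ (R′ k))` and fine functional
`G₂′ := W′ ↦ projG (fine (L^(k+1)) M) (Rlev (k+1)) (ker Q_{taxiTv (L^(k+1)) M (Rlev (k+1))}) (W′ ∘ sites (L^k) L M)` (parts 6–8 verbatim); the supplier's carriers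
`Q₁ := QvL L _ (frameT L _ T′ (Rlev k))` and functional `G₁′ := projG (fine L (fine (L^k) M)) (R′ k) (ker ((avgOp (L^k) M T).comp (avgOp L _ T′)))` (leaf-01-g8∕g9's
`hONEm_centred(_reg)` verbatim); `Q_k := QvL (L^k) M (nestLv k)`.
 * §1 `Gtr_G2'`, `SfV_G2'_eq`, `QvL_nestLv_succ_comp` (transport read-outs), **`hGar_succ_oneStep`**: the level-(k+1) (Går) for the straight-taxi kernel (part 6's
   `hGar_projG_nestLv` from the DISPLAYED (GF3)_{k+1}) in ONE-STEP letters: `c_f·roughV L (fine (L^k) M) (R′ k) g ≤ 2(1+C_D)·SfV (R′ k) G₂′ g + 2(C_D′ + 64d(L^{k+1})²b_k)·nsqV (Q_k(Q₂ g))`.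
 * §2 **`hG12_taxi`** (THE KERNEL SWAP): `c_f G₂′ g ≤ (1+u)·c_f G₁′ g + ((1+u⁻¹)δ_k²·d·(κ+κ′))·(SfV (R′ k) G₂′ g + nsqV (Q_k(Q₂ g)))`, `δ_k = 4·d(d(L(L^k−1)(L−1)b_k))·revPC d (L^k·L) w_k`,
   `w_k = (d−1)(L−1)(2L−1)b_k + (d−1)(L^k−1)a_k`, for any one-step (Går) constants `(κ, κ′)` — `projG_taxiTwoStep_eq` + file 2's `projG_taxi_le_comp` + `divSq ≤ d·rough`.
 * §3 **`hQ12_taxi`** (THE CARRIER DEFECT): `nsqV (Q_k(Q₁ g) − Q_k(Q₂ g)) ≤ (γ₀²·C_Pf)·(SfV (R′ k) G₂′ g + nsqV (Q_k(Q₂ g)))`, `γ₀ = 3((d−1)L(L−1)b_k)` (gen 4's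
   `lineT_sub_frameT_taxi_le`), `C_Pf = max (40κ) (64 + 40κ′)` (gen 5's fine V-P `qVV_le_nestLv_of_garding`), Jensen twice.
 * §4 **`hUBf2_taxi`** (THE FINE V-UB for (`Q₂`, `G₂′`)): gen 5's `exists_ubV_nestLv_SfV` with (GF1′) `projG ≤ d·rough` for the level-(k+1) straight-taxi kernel.
NOT HERE: the assembly through file 3's `hONEm_transfer` (file 4b `VariationalColourTaxiTowerOneMin`), the class bookkeeping (`δ_k, γ₀,k → 0` geometrically).

HONEST FRAMING (T4-DAG p. 1).  Rung (B)+1 only — NOT infinite volume, NOT a mass gap, NOT Clay.  NE2 NOT IN PRINT, NOT proved here.  MODEL LEVEL (c5): bond ∕ site operators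
DATA (`E = ℂ`, as in parts 6–8), taxi contours, carriers and both gauge fixings OURS; (GF3)_{k+1} DISPLAYED exactly as in part 6; [folklore] bookkeeping;
thresholds via `revPC` quantitatively void; nothing printed is a hypothesis; no `def`, no `def … : Prop`, no `sorry`; axioms standard.  V-END with background ∕ NE2 NOT
proved; NE3 OPEN; spine PROVED 0∕9 unchanged.  HONEST DEPENDENCY (cell, verbatim): continuum YM on T⁴ ⇐ BetaPertH ∧ nine spine estimates (0/9 proved); BetaPertH ⇐ (D1) ∧
(D4) ∧ CAP+tail; G-an2-4 gates asym, D1 and NE2/3/4.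
-/

noncomputable section

namespace Summit.QuantumFields.BalabanUV.T4Continuum.VariationalColourTaxiTransport

open Finset
open Literature.MathematicalPhysics.QuantumFieldTheory.Balaban1983to89.B5Prop11Plancherel (Tor fine unitVec)
open Literature.MathematicalPhysics.QuantumFieldTheory.Balaban1983to89.B5Composition116 (sites)
open Summit.QuantumFields.BalabanUV.T4Continuum.VariationalColourFederbush (norm_le_one_of_mem_unitary)
open Summit.QuantumFields.BalabanUV.T4Continuum.VariationalColourTower (compTv Rtrv)
open Summit.QuantumFields.BalabanUV.T4Continuum.VariationalVectorFederbush (lineT)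
open Summit.QuantumFields.BalabanUV.T4Continuum.VariationalVectorInterpolant (frameT)
open Summit.QuantumFields.BalabanUV.T4Continuum.VectorBlockTrialForm (nsqV nsqV_nonneg QvL roughV kappaV)
open Summit.QuantumFields.BalabanUV.T4Continuum.VariationalVectorForm (ScV SfV qWV qVV lamV lamV_nonneg ScV_nonneg SfV_nonneg qWV_nonneg)
open Summit.QuantumFields.BalabanUV.T4Continuum.VariationalVectorTower (Gtr SfV_eq_transport QvL_comp' roughV_transport)
open Summit.QuantumFields.BalabanUV.T4Continuum.VariationalVectorGaugeSliceTower (Gtr_pullback)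
open Summit.QuantumFields.BalabanUV.T4Continuum.VariationalVectorWeitzenbock (divSq divSq_nonneg divSq_le_mul_roughV)
open Summit.QuantumFields.BalabanUV.T4Continuum.VariationalVectorGaugeSlice (avgOp projG projG_nonneg QvL_sub)
open Summit.QuantumFields.BalabanUV.T4Continuum.VariationalVectorAverage (nsqV_QvL_le_qWV)
open Summit.QuantumFields.BalabanUV.T4Continuum.RegularGaugePerturbation (nsqV_QvL_le_of_norm_le)
open Summit.QuantumFields.BalabanUV.T4Continuum.CovariantBlockReversePoincare (revPC revPC_nonneg)
open Summit.QuantumFields.BalabanUV.T4Continuum.CompositeFibreRelabel (projG_taxiTwoStep_eq)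
open Summit.QuantumFields.BalabanUV.T4Continuum.CompositeTaxiFrameGap (projG_taxi_le_comp plaq_Rtrv_le)

variable {d : ℕ}
variable (L : ℕ) [NeZero L] (M : Fin d → ℕ) [hM : ∀ μ, NeZero (M μ)]
variable {R' : (k : ℕ) → Tor (fine L (fine (L ^ k) M)) → Fin d → (ℂ →L[ℂ] ℂ)} (hU : ∀ k x μ, R' k x μ ∈ unitary (ℂ →L[ℂ] ℂ)) {b : ℕ → ℝ}
  (hb : ∀ k x κ ι, ‖R' k x κ * R' k (x + unitVec (fine L (fine (L ^ k) M)) κ) ι - R' k x ι * R' k (x + unitVec (fine L (fine (L ^ k) M)) ι) κ‖ ≤ b k)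
  (hcoh : ∀ k, coarseTv L (fine (L ^ (k + 1)) M) (R' (k + 1)) = Rtrv (L ^ k) L M (R' k))

/-! ## §1 Transport read-outs and the level-(k+1) (Går) in one-step letters -/

section Readouts

omit [NeZero L] hM in
/-- the cast identity `(L^(k+1) : ℝ) = (L^k : ℝ)·L`. [folklore] -/
theorem cast_pow_succ (k : ℕ) : (((L ^ (k + 1) : ℕ) : ℝ)) = ((L ^ k : ℕ) : ℝ) * L := by push_cast; ring

/-- `Gtr` of the END's fine functional is the level-(k+1) straight-taxi functional (`Gtr_pullback`). [folklore] -/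
theorem Gtr_G2' (k : ℕ) :
    Gtr (L ^ k) L M (fun W' => projG (fine (L ^ (k + 1)) M) (Rlev L M R' (k + 1))
        (LinearMap.ker (avgOp (L ^ (k + 1)) M (taxiTv (L ^ (k + 1)) M (Rlev L M R' (k + 1))))) (W' ∘ sites (L ^ k) L M))
      = projG (fine (L ^ (k + 1)) M) (Rlev L M R' (k + 1)) (LinearMap.ker (avgOp (L ^ (k + 1)) M (taxiTv (L ^ (k + 1)) M (Rlev L M R' (k + 1))))) :=
  Gtr_pullback (L ^ k) L M _

/-- the one-step average of the END's carriers read at level k+1: `Q_k(Q₂ g) = QvL (L^(k+1)) M (nestLv (k+1)) (g ∘ sites)`. [folklore] -/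
theorem QvL_nestLv_succ_comp (k : ℕ) (g : Tor (fine L (fine (L ^ k) M)) → Fin d → ℂ) :
    QvL (L ^ k) M (nestLv L M R' k) (QvL L (fine (L ^ k) M) (lineT L (fine (L ^ k) M) (taxiTv L (fine (L ^ k) M) (R' k)) (R' k)) g)
      = QvL (L ^ (k + 1)) M (nestLv L M R' (k + 1)) (g ∘ sites (L ^ k) L M) :=
  QvL_comp' (L ^ k) L M _ _ g

/-- the fine form of the END's functional read at level k+1: `SfV (R′ k) G₂′ g = ScV (L^(k+1)) M (Rlev (k+1)) (projG_tx) (g ∘ sites)`. [folklore] -/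
theorem SfV_G2'_eq (k : ℕ) (g : Tor (fine L (fine (L ^ k) M)) → Fin d → ℂ) :
    SfV (L ^ k) L M (R' k) (fun W' => projG (fine (L ^ (k + 1)) M) (Rlev L M R' (k + 1))
        (LinearMap.ker (avgOp (L ^ (k + 1)) M (taxiTv (L ^ (k + 1)) M (Rlev L M R' (k + 1))))) (W' ∘ sites (L ^ k) L M)) g
      = ScV (L ^ (k + 1)) M (Rlev L M R' (k + 1)) (projG (fine (L ^ (k + 1)) M) (Rlev L M R' (k + 1))
          (LinearMap.ker (avgOp (L ^ (k + 1)) M (taxiTv (L ^ (k + 1)) M (Rlev L M R' (k + 1)))))) (g ∘ sites (L ^ k) L M) := by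
  rw [SfV_eq_transport, Gtr_G2']; rfl

include hU hb hcoh

/-- **THE LEVEL-(k+1) (Går) IN ONE-STEP LETTERS**: from the DISPLAYED (GF3)_{k+1} for the straight-taxi kernel (part 6's `hGar_projG_nestLv` at `k+1`, plaquette class of
`Rlev (k+1) = Rtrv (R′ k)` = that of `R′ k`): `c_f·roughV L (fine (L^k) M) (R′ k) g ≤ 2(1+C_D)·SfV (R′ k) G₂′ g + 2(C_D′ + d(L^{k+1})²b_k·64)·nsqV (Q_k(Q₂ g))`. [folklore] -/
theorem hGar_succ_oneStep (hM2 : ∀ μ, 1 < M μ) (k : ℕ) (hb0 : 0 ≤ b k)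
    (hsmall : 2 * (d : ℝ) * ((((L ^ (k + 1) : ℕ) : ℝ)) * (((d - 1 : ℕ) : ℝ) * ((L ^ (k + 1) - 1 : ℕ) : ℝ) * b k)) ^ 2 ≤ 1 / 2)
    (hγs : 64 * (∑ q ∈ Finset.range (k + 1), ((((d - 1 : ℕ) : ℝ) + (d : ℝ) * d) * (((L : ℝ) * ((L ^ q - 1 : ℕ) : ℝ) * ((L - 1 : ℕ) : ℝ)) * b q))) ^ 2 ≤ 1)
    (hsmall80 : 2 * 40 * ((d : ℝ) * ((((L ^ (k + 1) : ℕ) : ℝ)) ^ 2 * b k)) ≤ 1) {CD CD' : ℝ}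
    (hGdiv : ∀ W, ((((L ^ (k + 1) : ℕ) : ℝ)) ^ d)⁻¹ * ((((L ^ (k + 1) : ℕ) : ℝ)) ^ 2 * divSq (fine (L ^ (k + 1)) M) (Rlev L M R' (k + 1)) W)
      ≤ CD * ScV (L ^ (k + 1)) M (Rlev L M R' (k + 1)) (projG (fine (L ^ (k + 1)) M) (Rlev L M R' (k + 1))
          (LinearMap.ker (avgOp (L ^ (k + 1)) M (taxiTv (L ^ (k + 1)) M (Rlev L M R' (k + 1)))))) W
        + CD' * nsqV M (QvL (L ^ (k + 1)) M (nestLv L M R' (k + 1)) W))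
    (g : Tor (fine L (fine (L ^ k) M)) → Fin d → ℂ) :
    ((((L ^ k : ℕ) : ℝ) * L) ^ d)⁻¹ * ((((L ^ k : ℕ) : ℝ) * L) ^ 2 * roughV L (fine (L ^ k) M) (R' k) g)
      ≤ 2 * (1 + CD) * SfV (L ^ k) L M (R' k) (fun W' => projG (fine (L ^ (k + 1)) M) (Rlev L M R' (k + 1))
            (LinearMap.ker (avgOp (L ^ (k + 1)) M (taxiTv (L ^ (k + 1)) M (Rlev L M R' (k + 1))))) (W' ∘ sites (L ^ k) L M)) g
        + 2 * (CD' + d * ((((L ^ (k + 1) : ℕ) : ℝ)) ^ 2 * b k) * 64)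
          * nsqV M (QvL (L ^ k) M (nestLv L M R' k) (QvL L (fine (L ^ k) M) (lineT L (fine (L ^ k) M) (taxiTv L (fine (L ^ k) M) (R' k)) (R' k)) g)) := by
  have ha' : ∀ x κ ι, ‖Rlev L M R' (k + 1) x κ * Rlev L M R' (k + 1) (x + unitVec (fine (L ^ (k + 1)) M) κ) ι
      - Rlev L M R' (k + 1) x ι * Rlev L M R' (k + 1) (x + unitVec (fine (L ^ (k + 1)) M) ι) κ‖ ≤ b k := fun x κ ι => plaq_Rtrv_le (L ^ k) L M (hb k) x κ ι
  have h := hGar_projG_nestLv L M hU hb hcoh hM2 (k + 1) hb0 ha' hsmall hγs hsmall80 _ hGdiv (g ∘ sites (L ^ k) L M)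
  rw [SfV_G2'_eq, QvL_nestLv_succ_comp, ← roughV_transport (L ^ k) L M (R' k) g, ← cast_pow_succ]
  exact h

end Readouts

/-! ## §2 The kernel swap at taxi data -/

section KernelSwap

include hU hb hcoh

/-- **THE KERNEL SWAP AT TAXI DATA** (level `k`; `u > 0` free; one-step (Går) constants `(κ, κ′)` displayed — supplier `hGar_succ_oneStep`):
`c_f·G₂′ g ≤ (1+u)·c_f·G₁′ g + ((1+u⁻¹)·δ_k²·(d(κ+κ′)))·(SfV (R′ k) G₂′ g + nsqV (Q_k(Q₂ g)))`. [folklore] -/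
theorem hG12_taxi (hM2 : ∀ μ, 1 < M μ) (k : ℕ) {a : ℝ} (ha0 : 0 ≤ a)
    (ha : ∀ x κ ι, ‖Rlev L M R' k x κ * Rlev L M R' k (x + unitVec (fine (L ^ k) M) κ) ι - Rlev L M R' k x ι * Rlev L M R' k (x + unitVec (fine (L ^ k) M) ι) κ‖ ≤ a)
    (hb0 : 0 ≤ b k) (hsmall : 2 * (d : ℝ) * ((((L ^ (k + 1) : ℕ) : ℝ)) * (((d - 1 : ℕ) : ℝ) * ((L ^ (k + 1) - 1 : ℕ) : ℝ) * b k)) ^ 2 ≤ 1 / 2)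
    {κ κ' : ℝ} (hκ : 0 ≤ κ) (hκ' : 0 ≤ κ')
    (hGarf : ∀ g : Tor (fine L (fine (L ^ k) M)) → Fin d → ℂ,
      ((((L ^ k : ℕ) : ℝ) * L) ^ d)⁻¹ * ((((L ^ k : ℕ) : ℝ) * L) ^ 2 * roughV L (fine (L ^ k) M) (R' k) g)
        ≤ κ * SfV (L ^ k) L M (R' k) (fun W' => projG (fine (L ^ (k + 1)) M) (Rlev L M R' (k + 1))
              (LinearMap.ker (avgOp (L ^ (k + 1)) M (taxiTv (L ^ (k + 1)) M (Rlev L M R' (k + 1))))) (W' ∘ sites (L ^ k) L M)) g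
          + κ' * nsqV M (QvL (L ^ k) M (nestLv L M R' k) (QvL L (fine (L ^ k) M) (lineT L (fine (L ^ k) M) (taxiTv L (fine (L ^ k) M) (R' k)) (R' k)) g)))
    {u : ℝ} (hu : 0 < u) (g : Tor (fine L (fine (L ^ k) M)) → Fin d → ℂ) :
    ((((L ^ k : ℕ) : ℝ) * L) ^ d)⁻¹ * ((((L ^ k : ℕ) : ℝ) * L) ^ 2
        * projG (fine (L ^ (k + 1)) M) (Rlev L M R' (k + 1)) (LinearMap.ker (avgOp (L ^ (k + 1)) M (taxiTv (L ^ (k + 1)) M (Rlev L M R' (k + 1)))))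
            (g ∘ sites (L ^ k) L M))
      ≤ (1 + u) * (((((L ^ k : ℕ) : ℝ) * L) ^ d)⁻¹ * ((((L ^ k : ℕ) : ℝ) * L) ^ 2
            * projG (fine L (fine (L ^ k) M)) (R' k)
                (LinearMap.ker ((avgOp (L ^ k) M (taxiTv (L ^ k) M (Rlev L M R' k))).comp (avgOp L (fine (L ^ k) M) (taxiTv L (fine (L ^ k) M) (R' k))))) g))
        + ((1 + u⁻¹) * (4 * ((d : ℝ) * ((d : ℝ) * (((L : ℝ) * ((L ^ k - 1 : ℕ) : ℝ) * ((L - 1 : ℕ) : ℝ)) * b k)))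
              * revPC d (L ^ k * L) (((d - 1 : ℕ) : ℝ) * ((L - 1 : ℕ) : ℝ) * ((2 * L - 1 : ℕ) : ℝ) * b k + ((d - 1 : ℕ) : ℝ) * ((L ^ k - 1 : ℕ) : ℝ) * a)) ^ 2
            * ((d : ℝ) * (κ + κ')))
          * (SfV (L ^ k) L M (R' k) (fun W' => projG (fine (L ^ (k + 1)) M) (Rlev L M R' (k + 1))
                (LinearMap.ker (avgOp (L ^ (k + 1)) M (taxiTv (L ^ (k + 1)) M (Rlev L M R' (k + 1))))) (W' ∘ sites (L ^ k) L M)) g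
            + nsqV M (QvL (L ^ k) M (nestLv L M R' k) (QvL L (fine (L ^ k) M) (lineT L (fine (L ^ k) M) (taxiTv L (fine (L ^ k) M) (R' k)) (R' k)) g))) := by
  -- letters
  set cf : ℝ := ((((L ^ k : ℕ) : ℝ) * L) ^ d)⁻¹ * (((L ^ k : ℕ) : ℝ) * L) ^ 2 with hcf
  set δ : ℝ := 4 * ((d : ℝ) * ((d : ℝ) * (((L : ℝ) * ((L ^ k - 1 : ℕ) : ℝ) * ((L - 1 : ℕ) : ℝ)) * b k)))
      * revPC d (L ^ k * L) (((d - 1 : ℕ) : ℝ) * ((L - 1 : ℕ) : ℝ) * ((2 * L - 1 : ℕ) : ℝ) * b k + ((d - 1 : ℕ) : ℝ) * ((L ^ k - 1 : ℕ) : ℝ) * a) with hδ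
  have hcf0 : 0 ≤ cf := by positivity
  have hUk : ∀ x μ, Rlev L M R' k x μ ∈ unitary (ℂ →L[ℂ] ℂ) := Rlev_mem_unitary L M hU k
  have hUk1 : ∀ x μ, Rlev L M R' (k + 1) x μ ∈ unitary (ℂ →L[ℂ] ℂ) := Rlev_mem_unitary L M hU (k + 1)
  -- the coherence read-out: the coarse bonds of the one-step data ARE the level-k bonds
  have hC : coarseTv L (fine (L ^ k) M) (R' k) = Rlev L M R' k := coarseTv_eq_Rlev L M R' hcoh k
  have haC : ∀ y κ ι, ‖coarseTv L (fine (L ^ k) M) (R' k) y κ * coarseTv L (fine (L ^ k) M) (R' k) (y + unitVec (fine (L ^ k) M) κ) ι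
      - coarseTv L (fine (L ^ k) M) (R' k) y ι * coarseTv L (fine (L ^ k) M) (R' k) (y + unitVec (fine (L ^ k) M) ι) κ‖ ≤ a := by rw [hC]; exact ha
  -- leaf-03-g7's relabelling (`CompositeFibreRelabel`, p236855): the supplier's functional is the composite-frame functional pulled back
  have e1 := projG_taxiTwoStep_eq L M R' k g
  -- file 2: straight taxi against composite frames on the composite torus (coarse frames written with `coarseTv (R′ k)`)
  have hsmall' : 2 * (d : ℝ) * ((((L ^ k * L : ℕ) : ℝ)) * (((d - 1 : ℕ) : ℝ) * ((L ^ k * L - 1 : ℕ) : ℝ) * b k)) ^ 2 ≤ 1 / 2 := hsmall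
  have h2 := projG_taxi_le_comp (L ^ k) L M (hU k) (hb k) haC hM2 hb0 ha0 hsmall' hu (g ∘ sites (L ^ k) L M)
  rw [hC] at h2
  -- `h2 : projG_tx ≤ (1+u) projG_cp + (1+u⁻¹)(δ² divSq)` on `Tor (fine (L^k·L) M)` = `Tor (fine (L^(k+1)) M)`
  have h2' : projG (fine (L ^ (k + 1)) M) (Rlev L M R' (k + 1)) (LinearMap.ker (avgOp (L ^ (k + 1)) M (taxiTv (L ^ (k + 1)) M (Rlev L M R' (k + 1)))))
        (g ∘ sites (L ^ k) L M)
      ≤ (1 + u) * projG (fine L (fine (L ^ k) M)) (R' k)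
            (LinearMap.ker ((avgOp (L ^ k) M (taxiTv (L ^ k) M (Rlev L M R' k))).comp (avgOp L (fine (L ^ k) M) (taxiTv L (fine (L ^ k) M) (R' k))))) g
        + (1 + u⁻¹) * (δ ^ 2 * divSq (fine (L ^ (k + 1)) M) (Rlev L M R' (k + 1)) (g ∘ sites (L ^ k) L M)) := by
    rw [e1]; exact h2
  -- `divSq ≤ d·rough` at level k+1 and the one-step (Går)
  have h3 : divSq (fine (L ^ (k + 1)) M) (Rlev L M R' (k + 1)) (g ∘ sites (L ^ k) L M) ≤ d * roughV L (fine (L ^ k) M) (R' k) g := by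
    have h := divSq_le_mul_roughV (L ^ (k + 1)) M hUk1 (g ∘ sites (L ^ k) L M)
    rwa [show roughV (L ^ (k + 1)) M (Rlev L M R' (k + 1)) (g ∘ sites (L ^ k) L M) = roughV L (fine (L ^ k) M) (R' k) g from
      roughV_transport (L ^ k) L M (R' k) g] at h
  have h4 := hGarf g
  -- assemble in `cf` units
  have hδ0 : 0 ≤ δ ^ 2 := sq_nonneg _
  have hu1 : 0 ≤ 1 + u⁻¹ := by positivity
  have step : cf * ((1 + u⁻¹) * (δ ^ 2 * divSq (fine (L ^ (k + 1)) M) (Rlev L M R' (k + 1)) (g ∘ sites (L ^ k) L M)))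
      ≤ ((1 + u⁻¹) * δ ^ 2 * ((d : ℝ) * (κ + κ')))
          * (SfV (L ^ k) L M (R' k) (fun W' => projG (fine (L ^ (k + 1)) M) (Rlev L M R' (k + 1))
                (LinearMap.ker (avgOp (L ^ (k + 1)) M (taxiTv (L ^ (k + 1)) M (Rlev L M R' (k + 1))))) (W' ∘ sites (L ^ k) L M)) g
            + nsqV M (QvL (L ^ k) M (nestLv L M R' k) (QvL L (fine (L ^ k) M) (lineT L (fine (L ^ k) M) (taxiTv L (fine (L ^ k) M) (R' k)) (R' k)) g))) := by
    have hS0 : 0 ≤ SfV (L ^ k) L M (R' k) (fun W' => projG (fine (L ^ (k + 1)) M) (Rlev L M R' (k + 1))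
        (LinearMap.ker (avgOp (L ^ (k + 1)) M (taxiTv (L ^ (k + 1)) M (Rlev L M R' (k + 1))))) (W' ∘ sites (L ^ k) L M)) g :=
      SfV_nonneg (L ^ k) L M (R' k) (fun W' => projG_nonneg _ _ _ _) g
    have hN0 := nsqV_nonneg M (QvL (L ^ k) M (nestLv L M R' k) (QvL L (fine (L ^ k) M) (lineT L (fine (L ^ k) M) (taxiTv L (fine (L ^ k) M) (R' k)) (R' k)) g))
    -- `cf·divSq ≤ d·cf·rough ≤ d(κ S + κ′ N) ≤ d(κ+κ′)(S+N)`
    have a1 : cf * divSq (fine (L ^ (k + 1)) M) (Rlev L M R' (k + 1)) (g ∘ sites (L ^ k) L M) ≤ (d : ℝ) * (cf * roughV L (fine (L ^ k) M) (R' k) g) := by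
      nlinarith [mul_le_mul_of_nonneg_left h3 hcf0]
    have a2 : (d : ℝ) * (cf * roughV L (fine (L ^ k) M) (R' k) g)
        ≤ (d : ℝ) * (κ + κ') * (SfV (L ^ k) L M (R' k) (fun W' => projG (fine (L ^ (k + 1)) M) (Rlev L M R' (k + 1))
            (LinearMap.ker (avgOp (L ^ (k + 1)) M (taxiTv (L ^ (k + 1)) M (Rlev L M R' (k + 1))))) (W' ∘ sites (L ^ k) L M)) g
          + nsqV M (QvL (L ^ k) M (nestLv L M R' k) (QvL L (fine (L ^ k) M) (lineT L (fine (L ^ k) M) (taxiTv L (fine (L ^ k) M) (R' k)) (R' k)) g))) := by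
      have := mul_le_mul_of_nonneg_left h4 (Nat.cast_nonneg (α := ℝ) d)
      nlinarith [this, mul_nonneg hκ hN0, mul_nonneg hκ' hS0]
    have a3 := mul_le_mul_of_nonneg_left (a1.trans a2) (mul_nonneg hu1 hδ0)
    have e : cf * ((1 + u⁻¹) * (δ ^ 2 * divSq (fine (L ^ (k + 1)) M) (Rlev L M R' (k + 1)) (g ∘ sites (L ^ k) L M)))
        = (1 + u⁻¹) * δ ^ 2 * (cf * divSq (fine (L ^ (k + 1)) M) (Rlev L M R' (k + 1)) (g ∘ sites (L ^ k) L M)) := by ring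
    rw [e]
    refine a3.trans (le_of_eq ?_)
    ring
  have hmain := mul_le_mul_of_nonneg_left h2' hcf0
  have e2 : cf * ((1 + u) * projG (fine L (fine (L ^ k) M)) (R' k)
        (LinearMap.ker ((avgOp (L ^ k) M (taxiTv (L ^ k) M (Rlev L M R' k))).comp (avgOp L (fine (L ^ k) M) (taxiTv L (fine (L ^ k) M) (R' k))))) g
      + (1 + u⁻¹) * (δ ^ 2 * divSq (fine (L ^ (k + 1)) M) (Rlev L M R' (k + 1)) (g ∘ sites (L ^ k) L M)))
      = (1 + u) * (cf * projG (fine L (fine (L ^ k) M)) (R' k)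
          (LinearMap.ker ((avgOp (L ^ k) M (taxiTv (L ^ k) M (Rlev L M R' k))).comp (avgOp L (fine (L ^ k) M) (taxiTv L (fine (L ^ k) M) (R' k))))) g)
        + cf * ((1 + u⁻¹) * (δ ^ 2 * divSq (fine (L ^ (k + 1)) M) (Rlev L M R' (k + 1)) (g ∘ sites (L ^ k) L M))) := by ring
  rw [e2] at hmain
  have efin : ∀ X : ℝ, cf * X = ((((L ^ k : ℕ) : ℝ) * L) ^ d)⁻¹ * ((((L ^ k : ℕ) : ℝ) * L) ^ 2 * X) := fun X => by rw [hcf]; ring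
  rw [efin, efin] at hmain
  linarith [hmain, step]

end KernelSwap

/-! ## §3 The carrier defect at taxi data -/

section CarrierDefect

omit hM in
/-- the line-sum average is linear in the carrier: `QvL T W − QvL S W = QvL (T − S) W`. [folklore] -/
theorem QvL_sub_carrier {E : Type*} [NormedAddCommGroup E] [NormedSpace ℂ E] (n : ℕ) [NeZero n]
    (T S : Tor M → (Fin d → Fin n) → Fin n → Fin d → (E →L[ℂ] E)) (W : Tor (fine n M) → Fin d → E) :
    QvL n M T W - QvL n M S W = QvL n M (T - S) W := by
  funext y μ
  simp only [QvL, Pi.sub_apply, FunLike.coe_sub, sum_sub_distrib, smul_sub]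

include hU hb hcoh

/-- **THE CARRIER DEFECT AT TAXI DATA** (level `k`): with `γ₀ := 3((d−1)L(L−1)b_k)` (gen 4's `lineT_sub_frameT_taxi_le`, coarse bonds `coarseTv (R′ k) = Rlev k`) and the
fine V-P `qVV g ≤ C_Pf·(SfV (R′ k) G₂′ g + nsqV(Q_k(Q₂ g)))` DISPLAYED (supplier: gen 5's `qVV_le_nestLv_of_garding`):
`nsqV (Q_k(Q₁ g) − Q_k(Q₂ g)) ≤ (γ₀²·C_Pf)·(SfV (R′ k) G₂′ g + nsqV(Q_k(Q₂ g)))`. [folklore] -/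
theorem hQ12_taxi (k : ℕ) (hb0 : 0 ≤ b k) {CPf : ℝ}
    (hPf : ∀ g : Tor (fine L (fine (L ^ k) M)) → Fin d → ℂ, qVV (L ^ k) L M g
      ≤ CPf * (SfV (L ^ k) L M (R' k) (fun W' => projG (fine (L ^ (k + 1)) M) (Rlev L M R' (k + 1))
            (LinearMap.ker (avgOp (L ^ (k + 1)) M (taxiTv (L ^ (k + 1)) M (Rlev L M R' (k + 1))))) (W' ∘ sites (L ^ k) L M)) g
          + nsqV M (QvL (L ^ k) M (nestLv L M R' k) (QvL L (fine (L ^ k) M) (lineT L (fine (L ^ k) M) (taxiTv L (fine (L ^ k) M) (R' k)) (R' k)) g))))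
    (g : Tor (fine L (fine (L ^ k) M)) → Fin d → ℂ) :
    nsqV M (QvL (L ^ k) M (nestLv L M R' k) (QvL L (fine (L ^ k) M) (frameT L (fine (L ^ k) M) (taxiTv L (fine (L ^ k) M) (R' k)) (Rlev L M R' k)) g)
        - QvL (L ^ k) M (nestLv L M R' k) (QvL L (fine (L ^ k) M) (lineT L (fine (L ^ k) M) (taxiTv L (fine (L ^ k) M) (R' k)) (R' k)) g))
      ≤ ((3 * (((d - 1 : ℕ) : ℝ) * L * ((L - 1 : ℕ) : ℝ) * b k)) ^ 2 * CPf)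
          * (SfV (L ^ k) L M (R' k) (fun W' => projG (fine (L ^ (k + 1)) M) (Rlev L M R' (k + 1))
                (LinearMap.ker (avgOp (L ^ (k + 1)) M (taxiTv (L ^ (k + 1)) M (Rlev L M R' (k + 1))))) (W' ∘ sites (L ^ k) L M)) g
            + nsqV M (QvL (L ^ k) M (nestLv L M R' k) (QvL L (fine (L ^ k) M) (lineT L (fine (L ^ k) M) (taxiTv L (fine (L ^ k) M) (R' k)) (R' k)) g))) := by
  have hR' : ∀ x μ, ‖R' k x μ‖ ≤ 1 := fun x μ => norm_le_one_of_mem_unitary (hU k x μ)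
  have hR'all : ∀ k x μ, ‖R' k x μ‖ ≤ 1 := fun k x μ => norm_le_one_of_mem_unitary (hU k x μ)
  have hC : coarseTv L (fine (L ^ k) M) (R' k) = Rlev L M R' k := coarseTv_eq_Rlev L M R' hcoh k
  set γ₀ : ℝ := 3 * (((d - 1 : ℕ) : ℝ) * L * ((L - 1 : ℕ) : ℝ) * b k) with hγ₀
  have hγ₀0 : 0 ≤ γ₀ := by positivity
  -- the carrier difference, pointwise `≤ γ₀`
  have hD : ∀ y j t ν, ‖(frameT L (fine (L ^ k) M) (taxiTv L (fine (L ^ k) M) (R' k)) (Rlev L M R' k)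
      - lineT L (fine (L ^ k) M) (taxiTv L (fine (L ^ k) M) (R' k)) (R' k)) y j t ν‖ ≤ γ₀ := by
    intro y j t ν
    rw [Pi.sub_apply, Pi.sub_apply, Pi.sub_apply, Pi.sub_apply, norm_sub_rev, ← hC]
    exact lineT_sub_frameT_taxi_le L (fine (L ^ k) M) hR' (hb k) y j t ν
  -- the inner average: Jensen with carriers of size `γ₀`
  have h1 : nsqV (fine (L ^ k) M) (QvL L (fine (L ^ k) M) (frameT L (fine (L ^ k) M) (taxiTv L (fine (L ^ k) M) (R' k)) (Rlev L M R' k)) g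
        - QvL L (fine (L ^ k) M) (lineT L (fine (L ^ k) M) (taxiTv L (fine (L ^ k) M) (R' k)) (R' k)) g)
      ≤ γ₀ ^ 2 * qWV L (fine (L ^ k) M) g := by
    rw [QvL_sub_carrier]
    exact nsqV_QvL_le_of_norm_le L (fine (L ^ k) M) hγ₀0 hD g
  -- the outer average: Jensen with contractive carriers
  have h2 : nsqV M (QvL (L ^ k) M (nestLv L M R' k) (QvL L (fine (L ^ k) M) (frameT L (fine (L ^ k) M) (taxiTv L (fine (L ^ k) M) (R' k)) (Rlev L M R' k)) g)
        - QvL (L ^ k) M (nestLv L M R' k) (QvL L (fine (L ^ k) M) (lineT L (fine (L ^ k) M) (taxiTv L (fine (L ^ k) M) (R' k)) (R' k)) g))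
      ≤ qWV (L ^ k) M (QvL L (fine (L ^ k) M) (frameT L (fine (L ^ k) M) (taxiTv L (fine (L ^ k) M) (R' k)) (Rlev L M R' k)) g
          - QvL L (fine (L ^ k) M) (lineT L (fine (L ^ k) M) (taxiTv L (fine (L ^ k) M) (R' k)) (R' k)) g) := by
    rw [← QvL_sub]
    exact nsqV_QvL_le_qWV (L ^ k) M (norm_nestLv_le_one L M hR'all k) _
  -- units: `qWV_n (X) = n^{−d}·nsqV X` and `n^{−d}·γ₀²·L^{−d}·nsqV g = γ₀²·qVV g`
  have h3 : qWV (L ^ k) M (QvL L (fine (L ^ k) M) (frameT L (fine (L ^ k) M) (taxiTv L (fine (L ^ k) M) (R' k)) (Rlev L M R' k)) g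
          - QvL L (fine (L ^ k) M) (lineT L (fine (L ^ k) M) (taxiTv L (fine (L ^ k) M) (R' k)) (R' k)) g)
      ≤ γ₀ ^ 2 * qVV (L ^ k) L M g := by
    unfold qWV at h1 ⊢
    unfold qVV
    have hn : (0 : ℝ) ≤ ((((L ^ k : ℕ) : ℝ)) ^ d)⁻¹ := by positivity
    have h := mul_le_mul_of_nonneg_left h1 hn
    refine h.trans (le_of_eq ?_)
    push_cast
    ring
  have h4 := hPf g
  calc _ ≤ γ₀ ^ 2 * qVV (L ^ k) L M g := h2.trans h3
    _ ≤ γ₀ ^ 2 * (CPf * _) := mul_le_mul_of_nonneg_left h4 (sq_nonneg _)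
    _ = _ := by ring

end CarrierDefect

/-! ## §4 The fine V-UB leaf for the END's carriers and functional -/

section FineUB

include hU hb hcoh

/-- **THE FINE V-UB FOR (`Q₂`, `G₂′`) AT TAXI DATA** (gen 5's `exists_ubV_nestLv_SfV` with (GF1′) `projG ≤ d·rough` for the level-(k+1) straight-taxi kernel). [folklore] -/
theorem hUBf2_taxi (hd : 1 ≤ d) (k : ℕ) (hb0 : 0 ≤ b k)
    (hc : (kappaV d (L ^ (k + 1)))⁻¹ * ((∑ q ∈ Finset.range (k + 1), ((((d - 1 : ℕ) : ℝ) + (d : ℝ) * d) * (((L : ℝ) * ((L ^ q - 1 : ℕ) : ℝ) * ((L - 1 : ℕ) : ℝ)) * b q)))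
        + 3 * (((d - 1 : ℕ) : ℝ) * (L ^ (k + 1) : ℕ) * ((L ^ (k + 1) - 1 : ℕ) : ℝ) * b k)) < 1)
    (φ : Tor M → Fin d → ℂ) :
    ∃ W' : Tor (fine L (fine (L ^ k) M)) → Fin d → ℂ,
      QvL (L ^ k) M (nestLv L M R' k) (QvL L (fine (L ^ k) M) (lineT L (fine (L ^ k) M) (taxiTv L (fine (L ^ k) M) (R' k)) (R' k)) W') = φ ∧
      SfV (L ^ k) L M (R' k) (fun W' => projG (fine (L ^ (k + 1)) M) (Rlev L M R' (k + 1))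
          (LinearMap.ker (avgOp (L ^ (k + 1)) M (taxiTv (L ^ (k + 1)) M (Rlev L M R' (k + 1))))) (W' ∘ sites (L ^ k) L M)) W'
        ≤ lamV d ((L ^ (k + 1) : ℕ) * (((d - 1 : ℕ) : ℝ) * ((L ^ (k + 1) - 1 : ℕ) : ℝ) * b k)) d (((L ^ (k + 1) : ℕ) : ℝ) ^ 2 * 0)
          / (1 - (kappaV d (L ^ (k + 1)))⁻¹ * ((∑ q ∈ Finset.range (k + 1), ((((d - 1 : ℕ) : ℝ) + (d : ℝ) * d) * (((L : ℝ) * ((L ^ q - 1 : ℕ) : ℝ) * ((L - 1 : ℕ) : ℝ)) * b q)))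
              + 3 * (((d - 1 : ℕ) : ℝ) * (L ^ (k + 1) : ℕ) * ((L ^ (k + 1) - 1 : ℕ) : ℝ) * b k))) ^ 2 * nsqV M φ := by
  have ha' : ∀ x κ ι, ‖Rlev L M R' (k + 1) x κ * Rlev L M R' (k + 1) (x + unitVec (fine (L ^ (k + 1)) M) κ) ι
      - Rlev L M R' (k + 1) x ι * Rlev L M R' (k + 1) (x + unitVec (fine (L ^ (k + 1)) M) ι) κ‖ ≤ b k := fun x κ ι => plaq_Rtrv_le (L ^ k) L M (hb k) x κ ι
  refine exists_ubV_nestLv_SfV L M hU hb hcoh hd k hb0 ha' hc (Nat.cast_nonneg d) le_rfl (fun W => ?_) φ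
  rw [Gtr_G2']
  exact hGF_projG_taxi L M hU (k + 1) _ W

/-- **THE FINE V-P FOR (`Q₂`, `G₂′`) AT TAXI DATA** (gen 5's `qVV_le_nestLv_of_garding` over the level-(k+1) (Går) for the straight-taxi kernel from the DISPLAYED (GF3)_{k+1}):
`qVV g ≤ max(40κ, 64 + 40κ′)·(SfV (R′ k) G₂′ g + nsqV(Q_k(Q₂ g)))`, `κ = 2(1+C_D)`, `κ′ = 2(C_D′ + 64d(L^{k+1})²b_k)`. [folklore] -/
theorem hPf2_taxi (hM2 : ∀ μ, 1 < M μ) (k : ℕ) (hb0 : 0 ≤ b k)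
    (hsmall : 2 * (d : ℝ) * ((((L ^ (k + 1) : ℕ) : ℝ)) * (((d - 1 : ℕ) : ℝ) * ((L ^ (k + 1) - 1 : ℕ) : ℝ) * b k)) ^ 2 ≤ 1 / 2)
    (hγs : 64 * (∑ q ∈ Finset.range (k + 1), ((((d - 1 : ℕ) : ℝ) + (d : ℝ) * d) * (((L : ℝ) * ((L ^ q - 1 : ℕ) : ℝ) * ((L - 1 : ℕ) : ℝ)) * b q))) ^ 2 ≤ 1)
    (hsmall80 : 2 * 40 * ((d : ℝ) * ((((L ^ (k + 1) : ℕ) : ℝ)) ^ 2 * b k)) ≤ 1) {CD CD' : ℝ}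
    (hGdiv : ∀ W, ((((L ^ (k + 1) : ℕ) : ℝ)) ^ d)⁻¹ * ((((L ^ (k + 1) : ℕ) : ℝ)) ^ 2 * divSq (fine (L ^ (k + 1)) M) (Rlev L M R' (k + 1)) W)
      ≤ CD * ScV (L ^ (k + 1)) M (Rlev L M R' (k + 1)) (projG (fine (L ^ (k + 1)) M) (Rlev L M R' (k + 1))
          (LinearMap.ker (avgOp (L ^ (k + 1)) M (taxiTv (L ^ (k + 1)) M (Rlev L M R' (k + 1)))))) W
        + CD' * nsqV M (QvL (L ^ (k + 1)) M (nestLv L M R' (k + 1)) W))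
    (g : Tor (fine L (fine (L ^ k) M)) → Fin d → ℂ) :
    qVV (L ^ k) L M g ≤ max (40 * (2 * (1 + CD))) (64 + 40 * (2 * (CD' + d * ((((L ^ (k + 1) : ℕ) : ℝ)) ^ 2 * b k) * 64)))
      * (SfV (L ^ k) L M (R' k) (fun W' => projG (fine (L ^ (k + 1)) M) (Rlev L M R' (k + 1))
            (LinearMap.ker (avgOp (L ^ (k + 1)) M (taxiTv (L ^ (k + 1)) M (Rlev L M R' (k + 1))))) (W' ∘ sites (L ^ k) L M)) g
          + nsqV M (QvL (L ^ k) M (nestLv L M R' k) (QvL L (fine (L ^ k) M) (lineT L (fine (L ^ k) M) (taxiTv L (fine (L ^ k) M) (R' k)) (R' k)) g))) := by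
  have ha' : ∀ x κ ι, ‖Rlev L M R' (k + 1) x κ * Rlev L M R' (k + 1) (x + unitVec (fine (L ^ (k + 1)) M) κ) ι
      - Rlev L M R' (k + 1) x ι * Rlev L M R' (k + 1) (x + unitVec (fine (L ^ (k + 1)) M) ι) κ‖ ≤ b k := fun x κ ι => plaq_Rtrv_le (L ^ k) L M (hb k) x κ ι
  have hG0 : ∀ W, 0 ≤ Gtr (L ^ k) L M (fun W' => projG (fine (L ^ (k + 1)) M) (Rlev L M R' (k + 1))
      (LinearMap.ker (avgOp (L ^ (k + 1)) M (taxiTv (L ^ (k + 1)) M (Rlev L M R' (k + 1))))) (W' ∘ sites (L ^ k) L M)) W := fun W => by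
    rw [Gtr_G2']; exact projG_nonneg _ _ _ W
  refine qVV_le_nestLv_of_garding L M hU hb hcoh hM2 k ha' hsmall hγs hG0 (fun W => ?_) g
  rw [Gtr_G2']
  exact hGar_projG_nestLv L M hU hb hcoh hM2 (k + 1) hb0 ha' hsmall hγs hsmall80 _ hGdiv W

end FineUB

end Summit.QuantumFields.BalabanUV.T4Continuum.VariationalColourTaxiTransport

end
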